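import Literature.Barriers.ValiantsHypothesis.CT23ExplicitAnnihilatorEncoder
import Literature.Computability.AlgebraicComplexity.ConstantFreeNumerals
import HarnessLib

/-!
# Sign-constant circuits for the Kronecker powers `pow(i)_k` of the explicit annihilator encoder
# (Chatterjee–Tengse arXiv:2309.07612v2, proof of Lemma 3.5 = v1 Lemma 42: "`C_ℓ(α)` … computes
# `α^{2^ℓ}` by repeated squaring, constant-free, of size `O(ℓ + log α)`"; val-lit t20 g9, X-CT23
# support brick for the `HasSignConstants` twin R4 of `CT23ExplicitAnnihilatorCircuit.lean`)

Theorem-only (no definitions, no named facts). `CT23ExplicitAnnihilatorCircuit.lean` (val-lit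
p2 g8) builds stage A of the encoder circuit `M̃_G` from SMALLEST circuits for the coordinates
`kronPow a α Δ k = C(α^{Δ^k}) · ∏_ℓ (X(a ℓ) · C(α^{2^ℓ Δ^k}) + (1 − X(a ℓ)))` in Bürgisser's
`complexity` (all constants free; fine for Thm. 3.1). On the constant-free Lemma 4.7 path the
encoder must have SIGN CONSTANTS (`0, ±1` only), so the powers of the natural number `α` have to
be computed from `1 + 1 + ⋯` — this file supplies, for `α Δ : ℕ`, a fan-in-two circuit WITH SIGN
CONSTANTS computing EXACTLY the polynomial `kronPow a (α : F) Δ k`, of size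
`≤ 6·L + 3·log₂ α + 2·log₂(Δ^m) + 3` (`exists_signConst_kronPow`).

Route (the printed one, "repeated squaring"): `kronPow` is the image under `ℤ → F` of the
INTEGER template `y · ∏_{ℓ<L} (x_ℓ · y^{2^ℓ} + (1 − x_ℓ))` with `y ↦ C(α^{Δ^k})`, `x_ℓ ↦ X(a ℓ)`
(`kronPow_eq_aeval_template`); the template has `τ ≤ 6L + 1` by induction on `L` through the
shift identity `∏_{ℓ<L+1} f_ℓ(y) = f_0(y) · (∏_{ℓ<L} f_ℓ)(x_{ℓ+1}, y²)` (one squaring per level: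
`constantFreeComplexity_kronTemplate_le`, pure `τ`-calculus of `ConstantFreeCircuits.lean`); the
numeral power `C((α:F)^{Δ^k})` costs `≤ 3 log₂ α + 2(log₂ Δ^k + 1)` gates
(`ArithCircuit.exists_signConst_natCast_pow`), and the ring-generic substitution bound
`ArithCircuit.exists_signConst_aeval_int` (`ConstantFreeNumerals.lean`) assembles the circuit
over `F`. Honest framing: circuit bookkeeping for a printed `VPSPACE` construction; nothing here
bears on `VP ≠ VNP`, which is NOT proved.

## References
* [ChatterjeeTengse2023] P. Chatterjee, A. Tengse, *Lower Bounds from Succinct Hitting Sets*,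
  arXiv:2309.07612v2, proof of Lemma 3.5, circuits `C_ℓ(α)` and `pow` (v1: Lemma 42; held text
  p0015.txt:L70–L73, L86–L96).
* [Burgisser2000] P. Bürgisser, *Completeness and Reduction in Algebraic Complexity Theory*,
  §1.4 (`τ`), Rem. 2.7 (substitution), §4.1 (extension of scalars).
-/

noncomputable section

open MvPolynomial

namespace Literature.Barriers.ValiantsHypothesis

namespace CT23Encoder

open Literature.Computability.AlgebraicComplexity

universe u v

/-! ### The integer template of `pow(i)_k` and its `τ`-bound -/

section Template

/-- **Shift identity** of the template `∏_{ℓ<L} (x_ℓ · y^{2^ℓ} + (1 − x_ℓ))`: one more level is the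
first factor times the template at `(x_{ℓ+1})_ℓ` and `y²` (repeated squaring).
[cite: ChatterjeeTengse2023, proof of Lemma 3.5, `C_ℓ(α)` (v1: Lemma 42; p0015.txt:L86–L96)] -/
theorem kronTemplate_succ (L : ℕ) :
    (∏ l : Fin (L + 1), (X (Sum.inl l) * X (Sum.inr ()) ^ (2 ^ (l : ℕ)) + (1 - X (Sum.inl l))) :
      MvPolynomial (Fin (L + 1) ⊕ Unit) ℤ) =
    (X (Sum.inl 0) * X (Sum.inr ()) + (1 - X (Sum.inl 0))) *
      aeval (Sum.elim (fun l : Fin L => (X (Sum.inl l.succ) : MvPolynomial (Fin (L + 1) ⊕ Unit) ℤ))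
          (fun _ => X (Sum.inr ()) ^ 2))
        (∏ l : Fin L, (X (Sum.inl l) * X (Sum.inr ()) ^ (2 ^ (l : ℕ)) + (1 - X (Sum.inl l))) :
          MvPolynomial (Fin L ⊕ Unit) ℤ) := by
  rw [Fin.prod_univ_succ, map_prod]
  congr 1
  · simp
  · refine Finset.prod_congr rfl fun l _ => ?_
    simp only [map_add, map_mul, map_sub, map_one, map_pow, aeval_X, Sum.elim_inl, Sum.elim_inr,
      Fin.val_succ]
    rw [pow_succ', pow_mul]

/-- **`τ(∏_{ℓ<L} (x_ℓ · y^{2^ℓ} + (1 − x_ℓ))) ≤ 6L`** — each level costs one squaring of `y`, one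
product, `1 − x` (two gates in the tree's `τ`-calculus: `constantFreeComplexity_sub_le`), one sum,
and one product with the rest.
[cite: ChatterjeeTengse2023, proof of Lemma 3.5, size of `pow` (v1: Lemma 42; p0016.txt:L6); Burgisser2000, Rem. 2.7] -/
theorem constantFreeComplexity_kronTemplate_le (L : ℕ) :
    constantFreeComplexity (∏ l : Fin L, (X (Sum.inl l) * X (Sum.inr ()) ^ (2 ^ (l : ℕ)) +
      (1 - X (Sum.inl l))) : MvPolynomial (Fin L ⊕ Unit) ℤ) ≤ 6 * L := by
  induction L with
  | zero => simp [constantFreeComplexity_one]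
  | succ L ih =>
    rw [kronTemplate_succ]
    have hfac : constantFreeComplexity (X (Sum.inl 0) * X (Sum.inr ()) + (1 - X (Sum.inl 0)) :
        MvPolynomial (Fin (L + 1) ⊕ Unit) ℤ) ≤ 4 := by
      have h1 := constantFreeComplexity_mul_le (X (Sum.inl 0) : MvPolynomial (Fin (L + 1) ⊕ Unit) ℤ)
        (X (Sum.inr ()))
      have h2 := constantFreeComplexity_sub_le (1 : MvPolynomial (Fin (L + 1) ⊕ Unit) ℤ)
        (X (Sum.inl 0))
      have h3 := constantFreeComplexity_add_le
        (X (Sum.inl 0) * X (Sum.inr ()) : MvPolynomial (Fin (L + 1) ⊕ Unit) ℤ) (1 - X (Sum.inl 0))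
      rw [constantFreeComplexity_X, constantFreeComplexity_X] at h1
      rw [constantFreeComplexity_one, constantFreeComplexity_X] at h2
      omega
    have hsub := constantFreeComplexity_aeval_le
      (∏ l : Fin L, (X (Sum.inl l) * X (Sum.inr ()) ^ (2 ^ (l : ℕ)) + (1 - X (Sum.inl l))) :
        MvPolynomial (Fin L ⊕ Unit) ℤ)
      (Sum.elim (fun l : Fin L => (X (Sum.inl l.succ) : MvPolynomial (Fin (L + 1) ⊕ Unit) ℤ))
        (fun _ => X (Sum.inr ()) ^ 2))
    have hsum : ∑ i : Fin L ⊕ Unit, constantFreeComplexity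
        (Sum.elim (fun l : Fin L => (X (Sum.inl l.succ) : MvPolynomial (Fin (L + 1) ⊕ Unit) ℤ))
          (fun _ => X (Sum.inr ()) ^ 2) i) ≤ 1 := by
      rw [Fintype.sum_sum_type]
      simp only [Sum.elim_inl, Sum.elim_inr, constantFreeComplexity_X, Finset.sum_const_zero,
        zero_add, Fintype.sum_unique]
      have h := constantFreeComplexity_sq_le (X (Sum.inr ()) : MvPolynomial (Fin (L + 1) ⊕ Unit) ℤ)
      rw [constantFreeComplexity_X] at h
      omega
    have hA : constantFreeComplexity (aeval
        (Sum.elim (fun l : Fin L => (X (Sum.inl l.succ) : MvPolynomial (Fin (L + 1) ⊕ Unit) ℤ))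
          (fun _ => X (Sum.inr ()) ^ 2))
        (∏ l : Fin L, (X (Sum.inl l) * X (Sum.inr ()) ^ (2 ^ (l : ℕ)) + (1 - X (Sum.inl l))) :
          MvPolynomial (Fin L ⊕ Unit) ℤ)) ≤ 6 * L + 1 := hsub.trans (by omega)
    have hmul := constantFreeComplexity_mul_le
      (X (Sum.inl 0) * X (Sum.inr ()) + (1 - X (Sum.inl 0)) : MvPolynomial (Fin (L + 1) ⊕ Unit) ℤ)
      (aeval
        (Sum.elim (fun l : Fin L => (X (Sum.inl l.succ) : MvPolynomial (Fin (L + 1) ⊕ Unit) ℤ))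
          (fun _ => X (Sum.inr ()) ^ 2))
        (∏ l : Fin L, (X (Sum.inl l) * X (Sum.inr ()) ^ (2 ^ (l : ℕ)) + (1 - X (Sum.inl l))) :
          MvPolynomial (Fin L ⊕ Unit) ℤ))
    omega

/-- The full template `y · ∏_{ℓ<L} (x_ℓ · y^{2^ℓ} + (1 − x_ℓ))` has `τ ≤ 6L + 1`.
[cite: ChatterjeeTengse2023, proof of Lemma 3.5, size of `pow` (v1: Lemma 42; p0016.txt:L6)] -/
theorem constantFreeComplexity_kronTemplate_mul_le (L : ℕ) :
    constantFreeComplexity (X (Sum.inr ()) * ∏ l : Fin L, (X (Sum.inl l) * X (Sum.inr ()) ^ (2 ^ (l : ℕ)) +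
      (1 - X (Sum.inl l))) : MvPolynomial (Fin L ⊕ Unit) ℤ) ≤ 6 * L + 1 := by
  have h := constantFreeComplexity_mul_le (X (Sum.inr ()) : MvPolynomial (Fin L ⊕ Unit) ℤ)
    (∏ l : Fin L, (X (Sum.inl l) * X (Sum.inr ()) ^ (2 ^ (l : ℕ)) + (1 - X (Sum.inl l))))
  rw [constantFreeComplexity_X] at h
  have h' := constantFreeComplexity_kronTemplate_le L
  omega

end Template

/-! ### `pow(i)_k` with sign constants -/

section KronPow

variable {F : Type u} [Field F] {τ : Type v} {L m : ℕ}

/-- **`kronPow` is the integer template at `y = α^{Δ^k}`, `x_ℓ = X(a ℓ)`** (for every `α ∈ F`: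
`C(α^{2^ℓ Δ^k}) = C(α^{Δ^k})^{2^ℓ}`). [cite: ChatterjeeTengse2023, proof of Lemma 3.5, `pow(i)` (v1: Lemma 42; p0015.txt:L86–L96)] -/
theorem kronPow_eq_aeval_template (a : Fin L → τ) (α : F) (Δ : ℕ) (k : Fin m) :
    kronPow a α Δ k =
      aeval (Sum.elim (fun l => (X (a l) : MvPolynomial τ F)) (fun _ => C (α ^ Δ ^ (k : ℕ))))
        (MvPolynomial.map (Int.castRingHom F)
          (X (Sum.inr ()) * ∏ l : Fin L, (X (Sum.inl l) * X (Sum.inr ()) ^ (2 ^ (l : ℕ)) +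
            (1 - X (Sum.inl l))) : MvPolynomial (Fin L ⊕ Unit) ℤ)) := by
  rw [kronPow]
  simp only [map_mul, map_prod, map_add, map_sub, map_one, map_pow, map_X, aeval_X, Sum.elim_inl,
    Sum.elim_inr]
  congr 1
  refine Finset.prod_congr rfl fun l _ => ?_
  rw [← pow_mul, mul_comm (Δ ^ (k : ℕ))]

/-- `log₂ Δ^k ≤ log₂ Δ^m` for `k ≤ m` (also when `Δ = 0`). [folklore] -/
private theorem log_pow_le_log_pow {Δ k m : ℕ} (hk : k ≤ m) :
    Nat.log 2 (Δ ^ k) ≤ Nat.log 2 (Δ ^ m) := by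
  rcases Nat.eq_zero_or_pos Δ with rfl | hΔ
  · rcases Nat.eq_zero_or_pos k with rfl | hk0
    · simp
    · rw [zero_pow hk0.ne']; simp
  · exact Nat.log_mono_right (Nat.pow_le_pow_right hΔ hk)

/-- **`pow(i)_k` with sign constants.** For natural numbers `α, Δ`, the coordinate polynomial
`kronPow a (α : F) Δ k` is computed by a fan-in-two circuit over `F` whose constants are `0, ±1`
only, of size `≤ 6L + 3 log₂ α + 2 log₂(Δ^m) + 3` ("`pow` … constant-free … size
`O(n log(nd) + log α)`"). [cite: ChatterjeeTengse2023, proof of Lemma 3.5, `C_ℓ(α)` / `pow` (v1: Lemma 42; p0015.txt:L70–L73, L86–L96; p0016.txt:L6)] -/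
theorem exists_signConst_kronPow (a : Fin L → τ) (α Δ : ℕ) (k : Fin m) :
    ∃ P : ArithCircuit F τ, P.IsFanInTwo ∧ P.HasSignConstants ∧
      P.Computes (kronPow a (α : F) Δ k) ∧
      P.size ≤ 6 * L + 3 * Nat.log 2 α + 2 * Nat.log 2 (Δ ^ m) + 3 := by
  obtain ⟨Pc, hc1, hc2, hc3, hc4⟩ :=
    ArithCircuit.exists_signConst_natCast_pow (k := F) (σ := τ) α (Δ ^ (k : ℕ))
  obtain ⟨P, h1, h2, h3, h4⟩ := ArithCircuit.exists_signConst_aeval_int (k := F) (σ := τ)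
    (X (Sum.inr ()) * ∏ l : Fin L, (X (Sum.inl l) * X (Sum.inr ()) ^ (2 ^ (l : ℕ)) +
      (1 - X (Sum.inl l))) : MvPolynomial (Fin L ⊕ Unit) ℤ)
    (Q := Sum.elim (fun l => ArithCircuit.ofVar (a l)) (fun _ => Pc))
    (g := Sum.elim (fun l => (X (a l) : MvPolynomial τ F)) (fun _ => C ((α : F) ^ Δ ^ (k : ℕ))))
    (by rintro (l | u); exacts [ArithCircuit.IsFanInTwo.ofVar _, hc1])
    (by rintro (l | u); exacts [ArithCircuit.HasSignConstants.ofVar _, hc2])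
    (by rintro (l | u); exacts [rfl, hc3])
  refine ⟨P, h1, h2, ?_, ?_⟩
  · rw [ArithCircuit.Computes] at h3 ⊢
    rw [h3, kronPow_eq_aeval_template]
  · simp only [Fintype.sum_sum_type, Fintype.sum_unique, Sum.elim_inl, Sum.elim_inr,
      ArithCircuit.size_ofVar, Finset.sum_const_zero, zero_add] at h4
    have key : constantFreeComplexity (X (Sum.inr ()) * ∏ l : Fin L, (X (Sum.inl l) *
        X (Sum.inr ()) ^ (2 ^ (l : ℕ)) + (1 - X (Sum.inl l))) : MvPolynomial (Fin L ⊕ Unit) ℤ) +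
          Pc.size ≤ (6 * L + 1) + (3 * Nat.log 2 α + 2 * (Nat.log 2 (Δ ^ (k : ℕ)) + 1)) :=
      Nat.add_le_add (constantFreeComplexity_kronTemplate_mul_le L) hc4
    have hlog := log_pow_le_log_pow (Δ := Δ) k.is_lt.le
    have h5 := h4.trans key
    omega

/-- **Stage A with sign constants, as a family** (the shape consumed by
`CT23Encoder.exists_encoderCircuit_signConst`: circuits `A k`, fan-in two, computing `kronPow`,
of size `≤ sA := 6L + 3 log₂ α + 2 log₂(Δ^m) + 3`, with sign constants).
[cite: ChatterjeeTengse2023, proof of Lemma 3.5, `pow` (v1: Lemma 42; p0015.txt:L86–L96; p0016.txt:L6)] -/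
theorem exists_signConst_kronPow_family (a : Fin L → τ) (α Δ m : ℕ) :
    ∃ A : Fin m → ArithCircuit F τ, (∀ k, (A k).IsFanInTwo) ∧
      (∀ k, (A k).Computes (kronPow a (α : F) Δ k)) ∧
      (∀ k, (A k).size ≤ 6 * L + 3 * Nat.log 2 α + 2 * Nat.log 2 (Δ ^ m) + 3) ∧
      ∀ k, (A k).HasSignConstants := by
  choose A h1 h2 h3 h4 using fun k : Fin m => exists_signConst_kronPow (F := F) a α Δ k
  exact ⟨A, h1, h3, h4, h2⟩

end KronPow

end CT23Encoder

end Literature.Barriers.ValiantsHypothesis
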